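import Mathlib
import Literature.Probability.LatticeModels.IsoradialPercolation
import HarnessLib

/-!
# The upward growth rate of an open path under a track exchange is `< 1`

Grimmett–Manolescu, *Bond percolation on isoradial graphs* (PTRF 159 (2014) 273–327 =
arXiv:1204.0505), §6.2, Lemma 6.6 (arXiv v2: "Lemma 17", column growth control) and the end of
its proof. When the track exchange `Σ_l` passes an open path whose height in column `n` is
`l = H^k_n`, the height can increase to `l + 1` only through the *secondary outcome* of a
star–triangle move (GM14 Figure 5.4, third and sixth lines), which "occurs with probability
`η_k(n) := p_{π-ξ+α_n} p_{π-β_k+ξ} / (p_{ξ-α_n} p_{β_k-ξ})` if the edge `e` is open".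
With `A = ξ - α_n`, `B = β_k - ξ` and GM14 (2.3) (`p_θ/(1-p_θ) = sin(⅓(π-θ))/sin(⅓θ)`),
"`η_k(n) = p_{π-A} p_{π-B} / (p_A p_B) = sin(⅓A) sin(⅓B) / (sin(⅓[π-A]) sin(⅓[π-B])) = g(A, B)`
[…] By assumption, `B > 0`, and so by (bounded angles) `ε ≤ A ≤ A + B ≤ π - ε`. There exists
`c(ε) > 0` such that […] `cos(⅓[A+B]) ≥ cos(⅓[2π-A-B]) + c(ε)`. Therefore
`η := sup{g(A,B) : ε ≤ A ≤ A + B ≤ π - ε}` satisfies `η < 1`." This `η = η(ε)` is the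
Bernoulli parameter of the growth process of
`Literature.Probability.Percolation.GrowthProcessDomination` (GM14 Lemma 6.7).

This file proves the bound with an explicit constant:

* `GrowthProcess.rateBound ε = 1 / (1 + 2√3 sin(ε/3))`, `rateBound_lt_one` (`0 < ε ≤ π/2`);
* `GrowthProcess.sin_third_mul_sin_third_le` — the trigonometric core
  `(1 + 2√3 sin(ε/3)) sin(A/3) sin(B/3) ≤ sin((π-A)/3) sin((π-B)/3)` for `0 ≤ ε ≤ A`, `0 ≤ B`,
  `A + B ≤ π - ε` (GM's `c(ε)` is `cos(⅓(π-ε)) - cos(⅓(π+ε)) = √3 sin(ε/3)`, and the numerator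
  `cos(⅓(A-B)) - cos(⅓(A+B))` is at most `1 - cos(⅓(π-ε)) ≤ ½`);
* `GrowthProcess.sin_div_sin_le_rateBound` — `g(A, B) ≤ η(ε)`;
* `GrowthProcess.criticalWeight_half_mul_sin`, `GrowthProcess.criticalWeight_mul_le_rateBound_mul`
  — the same in the tree's vocabulary: GM14's `p_θ` (`θ` = rhombus angle at the face centre) is
  `LatticeModels.criticalWeight ((π - θ)/2)` (H21 half-angle convention), `p_{π-A}/p_A =
  sin(A/3)/sin((π-A)/3)`, and `p_{π-A} p_{π-B} ≤ η(ε) p_A p_B`.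

Only the inequality `η(ε) < 1` is used downstream (GM14 take `η` to be the supremum; any
explicit majorant `< 1` serves, since the growth-process lemma holds for every `η < 1`).

## References

* G. R. Grimmett, I. Manolescu, PTRF 159 (2014) 273–327, arXiv:1204.0505: §2.2 (2.3); §6.2,
  Lemma 6.6 and the end of its proof (the function `g(A, B)`, the constant `c(ε)`, `η < 1`).
-/

noncomputable section

namespace Literature.Probability.Percolation

open Real LatticeModels

namespace GrowthProcess

/-- The explicit bound `η(ε) = 1 / (1 + 2√3 sin(ε/3))` for the parameter of the growth
process. [cite: GrimmettManolescu2014Isoradial, §6.2 end of proof of Lemma 6.6] -/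
def rateBound (ε : ℝ) : ℝ := 1 / (1 + 2 * Real.sqrt 3 * Real.sin (ε / 3))

/-- `η(ε) < 1` for `0 < ε ≤ π/2` (indeed for `0 < ε < 3π`).
[cite: GrimmettManolescu2014Isoradial, §6.2 end of proof of Lemma 6.6] -/
theorem rateBound_lt_one {ε : ℝ} (hε : 0 < ε) (hεπ : ε ≤ π / 2) : rateBound ε < 1 := by
  have hs : 0 < Real.sin (ε / 3) :=
    Real.sin_pos_of_pos_of_lt_pi (by positivity) (by linarith [Real.pi_pos])
  have h3 : 0 < Real.sqrt 3 := by positivity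
  unfold rateBound
  rw [div_lt_one (by positivity)]
  nlinarith [mul_pos h3 hs]

/-- `0 < η(ε)` for `0 ≤ ε ≤ π/2`. [folklore] -/
theorem rateBound_pos {ε : ℝ} (hε : 0 ≤ ε) (hεπ : ε ≤ π / 2) : 0 < rateBound ε := by
  have hs : 0 ≤ Real.sin (ε / 3) :=
    Real.sin_nonneg_of_nonneg_of_le_pi (by positivity) (by linarith [Real.pi_pos])
  unfold rateBound
  positivity

/-- **Trigonometric core** (Grimmett–Manolescu 2014, §6.2, end of the proof of Lemma 6.6:
"`g(A, B) = [cos(⅓(A-B)) - cos(⅓(A+B))] / [cos(⅓(A-B)) - cos(⅓(2π-A-B))]` […] There exists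
`c(ε) > 0` such that, subject to `ε ≤ A ≤ A + B ≤ π - ε`,
`cos(⅓(A-B)) ≥ cos(⅓(A+B)) ≥ cos(⅓(2π-A-B)) + c(ε)`. Therefore
`η := sup{g(A, B)} < 1`"), in product form and with the explicit constant
`c(ε) = √3 sin(ε/3)`: `(1 + 2√3 sin(ε/3)) sin(A/3) sin(B/3) ≤ sin((π-A)/3) sin((π-B)/3)`.
[cite: GrimmettManolescu2014Isoradial, §6.2 end of proof of Lemma 6.6] -/
theorem sin_third_mul_sin_third_le {ε A B : ℝ} (hε : 0 ≤ ε) (hA : ε ≤ A) (hB : 0 ≤ B)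
    (hAB : A + B ≤ π - ε) :
    (1 + 2 * Real.sqrt 3 * Real.sin (ε / 3)) * (Real.sin (A / 3) * Real.sin (B / 3)) ≤
      Real.sin ((π - A) / 3) * Real.sin ((π - B) / 3) := by
  -- product-to-sum
  set x := A / 3 with hx
  set y := B / 3 with hy
  have hx0 : 0 ≤ x := by rw [hx]; linarith
  have hy0 : 0 ≤ y := by rw [hy]; linarith
  have hxy : x + y ≤ (π - ε) / 3 := by rw [hx, hy]; linarith
  have hn : Real.sin x * Real.sin y = (Real.cos (x - y) - Real.cos (x + y)) / 2 := by
    rw [Real.cos_sub, Real.cos_add]; ring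
  have hd : Real.sin ((π - A) / 3) * Real.sin ((π - B) / 3) =
      (Real.cos (x - y) - Real.cos (2 * π / 3 - (x + y))) / 2 := by
    have e1 : (π - A) / 3 = π / 3 - x := by rw [hx]; ring
    have e2 : (π - B) / 3 = π / 3 - y := by rw [hy]; ring
    rw [e1, e2, show x - y = (π / 3 - y) - (π / 3 - x) by ring,
      show 2 * π / 3 - (x + y) = (π / 3 - x) + (π / 3 - y) by ring, Real.cos_sub, Real.cos_add]
    ring
  -- the constant `c(ε) = cos((π-ε)/3) - cos((π+ε)/3) = √3 sin(ε/3)`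
  have hc : Real.cos ((π - ε) / 3) - Real.cos ((π + ε) / 3) = Real.sqrt 3 * Real.sin (ε / 3) := by
    rw [show (π - ε) / 3 = π / 3 - ε / 3 by ring, show (π + ε) / 3 = π / 3 + ε / 3 by ring,
      Real.cos_sub, Real.cos_add, Real.sin_pi_div_three]
    ring
  -- `cos(x+y) ≥ cos((π-ε)/3) ≥ 1/2` and `cos(2π/3-(x+y)) ≤ cos((π+ε)/3)`
  have h1 : Real.cos ((π - ε) / 3) ≤ Real.cos (x + y) :=
    Real.cos_le_cos_of_nonneg_of_le_pi (by linarith) (by linarith [Real.pi_pos]) hxy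
  have h2 : Real.cos (2 * π / 3 - (x + y)) ≤ Real.cos ((π + ε) / 3) :=
    Real.cos_le_cos_of_nonneg_of_le_pi (by linarith [Real.pi_pos]) (by linarith [Real.pi_pos])
      (by linarith)
  have h3 : (1 : ℝ) / 2 ≤ Real.cos ((π - ε) / 3) := by
    rw [← Real.cos_pi_div_three]
    exact Real.cos_le_cos_of_nonneg_of_le_pi (by linarith [Real.pi_pos])
      (by linarith [Real.pi_pos]) (by linarith)
  have h4 : Real.cos (x - y) ≤ 1 := Real.cos_le_one _
  -- `0 ≤ n := cos(x-y) - cos(x+y)` (it is `2 sin x sin y` with `x, y ∈ [0, π/3]`)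
  have hsx : 0 ≤ Real.sin x := Real.sin_nonneg_of_nonneg_of_le_pi hx0 (by linarith [Real.pi_pos])
  have hsy : 0 ≤ Real.sin y := Real.sin_nonneg_of_nonneg_of_le_pi hy0 (by linarith [Real.pi_pos])
  have hn0 : 0 ≤ Real.cos (x - y) - Real.cos (x + y) := by nlinarith [mul_nonneg hsx hsy]
  have hs3 : 0 ≤ Real.sqrt 3 * Real.sin (ε / 3) := by
    have : 0 ≤ Real.sin (ε / 3) :=
      Real.sin_nonneg_of_nonneg_of_le_pi (by positivity) (by linarith [Real.pi_pos])
    positivity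
  rw [hn, hd]
  nlinarith [mul_nonneg hs3 hn0]

/-- **The growth parameter is `< 1`** (Grimmett–Manolescu 2014, §6.2, Lemma 6.6 and the end of
its proof): for `ε ≤ A`, `0 ≤ B`, `A + B ≤ π - ε`,
`g(A, B) = sin(A/3) sin(B/3) / (sin((π-A)/3) sin((π-B)/3)) ≤ η(ε) = 1/(1 + 2√3 sin(ε/3))`,
and `η(ε) < 1` (`rateBound_lt_one`). Here `g(A, B) = p_{π-A} p_{π-B} / (p_A p_B)` is the
probability `η_k(n)` of the "secondary outcome" of the star–triangle moves of a track exchange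
(GM14 Figure 5.4), `p_θ / (1 - p_θ) = sin(⅓(π-θ)) / sin(⅓θ)` (GM14 (2.3)).
[cite: GrimmettManolescu2014Isoradial, §6.2 end of proof of Lemma 6.6] -/
theorem sin_div_sin_le_rateBound {ε A B : ℝ} (hε : 0 < ε) (hA : ε ≤ A) (hB : 0 ≤ B)
    (hAB : A + B ≤ π - ε) :
    Real.sin (A / 3) * Real.sin (B / 3) / (Real.sin ((π - A) / 3) * Real.sin ((π - B) / 3)) ≤
      rateBound ε := by
  have hpos : 0 < Real.sin ((π - A) / 3) * Real.sin ((π - B) / 3) := by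
    refine mul_pos (Real.sin_pos_of_pos_of_lt_pi ?_ ?_) (Real.sin_pos_of_pos_of_lt_pi ?_ ?_) <;>
      first
      | (apply div_pos <;> linarith)
      | (rw [div_lt_iff₀ (by norm_num : (0 : ℝ) < 3)]; nlinarith [Real.pi_pos])
  have hk : 0 < 1 + 2 * Real.sqrt 3 * Real.sin (ε / 3) := by
    have : 0 ≤ Real.sin (ε / 3) :=
      Real.sin_nonneg_of_nonneg_of_le_pi (by positivity) (by linarith [Real.pi_pos])
    positivity
  rw [div_le_iff₀ hpos, rateBound, one_div, inv_mul_eq_div, le_div_iff₀ hk, mul_comm]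
  exact sin_third_mul_sin_third_le hε.le hA hB hAB

/-- In the tree's half-angle convention (`LatticeModels.criticalWeight θ'` with
`p / (1 - p) = sin(2θ'/3) / sin((π - 2θ')/3)`, so that GM14's `p_θ = criticalWeight ((π - θ)/2)`):
the ratio `p_{π-A} / p_A` equals `sin(A/3) / sin((π-A)/3)`, i.e.
`criticalWeight (A/2) · sin((π-A)/3) = criticalWeight ((π-A)/2) · sin(A/3)`.
[cite: GrimmettManolescu2014Isoradial, §6.2 (the display computing η_k(n)) and (2.3)] -/
theorem criticalWeight_half_mul_sin (A : ℝ) :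
    criticalWeight (A / 2) * Real.sin ((π - A) / 3) =
      criticalWeight ((π - A) / 2) * Real.sin (A / 3) := by
  unfold criticalWeight
  have e1 : 2 * (A / 2) / 3 = A / 3 := by ring
  have e2 : (π - 2 * (A / 2)) / 3 = (π - A) / 3 := by ring
  have e3 : 2 * ((π - A) / 2) / 3 = (π - A) / 3 := by ring
  have e4 : (π - 2 * ((π - A) / 2)) / 3 = A / 3 := by ring
  rw [e1, e2, e3, e4, add_comm (Real.sin ((π - A) / 3))]
  ring

/-- **GM14 Lemma 6.6's parameter bound in the tree's vocabulary**: with GM14's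
`p_θ = criticalWeight ((π-θ)/2)`, the secondary-outcome probability
`η_k(n) = p_{π-A} p_{π-B} / (p_A p_B) = criticalWeight (A/2) criticalWeight (B/2) /
(criticalWeight ((π-A)/2) criticalWeight ((π-B)/2))` is at most `η(ε) = rateBound ε < 1`
whenever `ε ≤ A`, `0 ≤ B`, `A + B ≤ π - ε` (GM14: "`Y_n` […] Bernoulli random variables with
respective parameters `η_k(n) := p_{π-ξ+α_n} p_{π-β_k+ξ} / (p_{ξ-α_n} p_{β_k-ξ})` […]
`η := sup{g(A,B) : ε ≤ A ≤ A + B ≤ π - ε}` satisfies `η < 1`").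
[cite: GrimmettManolescu2014Isoradial, §6.2 Lemma 6.6 and end of its proof] -/
theorem criticalWeight_mul_le_rateBound_mul {ε A B : ℝ} (hε : 0 < ε) (hA : ε ≤ A) (hB : 0 ≤ B)
    (hAB : A + B ≤ π - ε) :
    criticalWeight (A / 2) * criticalWeight (B / 2) ≤
      rateBound ε * (criticalWeight ((π - A) / 2) * criticalWeight ((π - B) / 2)) := by
  -- all four weights share the positive denominators `sin(A/3) + sin((π-A)/3)` etc.
  have hsA : 0 < Real.sin ((π - A) / 3) := by
    refine Real.sin_pos_of_pos_of_lt_pi ?_ ?_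
    · apply div_pos <;> linarith
    · rw [div_lt_iff₀ (by norm_num : (0 : ℝ) < 3)]; nlinarith [Real.pi_pos]
  have hsB : 0 < Real.sin ((π - B) / 3) := by
    refine Real.sin_pos_of_pos_of_lt_pi ?_ ?_
    · apply div_pos <;> linarith
    · rw [div_lt_iff₀ (by norm_num : (0 : ℝ) < 3)]; nlinarith [Real.pi_pos]
  have hsA' : 0 ≤ Real.sin (A / 3) :=
    Real.sin_nonneg_of_nonneg_of_le_pi (by linarith) (by linarith [Real.pi_pos])
  have hsB' : 0 ≤ Real.sin (B / 3) :=
    Real.sin_nonneg_of_nonneg_of_le_pi (by linarith) (by linarith [Real.pi_pos])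
  have hwA : criticalWeight ((π - A) / 2) = Real.sin ((π - A) / 3) /
      (Real.sin ((π - A) / 3) + Real.sin (A / 3)) := by
    unfold criticalWeight; congr 1 <;> [congr 1; congr 1] <;> (try congr 1) <;> ring_nf
  have hwA' : criticalWeight (A / 2) = Real.sin (A / 3) /
      (Real.sin (A / 3) + Real.sin ((π - A) / 3)) := by
    unfold criticalWeight; congr 1 <;> [congr 1; congr 1] <;> (try congr 1) <;> ring_nf
  have hwB : criticalWeight ((π - B) / 2) = Real.sin ((π - B) / 3) /
      (Real.sin ((π - B) / 3) + Real.sin (B / 3)) := by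
    unfold criticalWeight; congr 1 <;> [congr 1; congr 1] <;> (try congr 1) <;> ring_nf
  have hwB' : criticalWeight (B / 2) = Real.sin (B / 3) /
      (Real.sin (B / 3) + Real.sin ((π - B) / 3)) := by
    unfold criticalWeight; congr 1 <;> [congr 1; congr 1] <;> (try congr 1) <;> ring_nf
  have hDA : 0 < Real.sin (A / 3) + Real.sin ((π - A) / 3) := by linarith
  have hDB : 0 < Real.sin (B / 3) + Real.sin ((π - B) / 3) := by linarith
  have hcore := sin_third_mul_sin_third_le hε.le hA hB hAB
  have hk : 0 < 1 + 2 * Real.sqrt 3 * Real.sin (ε / 3) := by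
    have : 0 ≤ Real.sin (ε / 3) :=
      Real.sin_nonneg_of_nonneg_of_le_pi (by positivity) (by linarith [Real.pi_pos])
    positivity
  rw [hwA, hwA', hwB, hwB', rateBound, add_comm (Real.sin ((π - A) / 3)),
    add_comm (Real.sin ((π - B) / 3))]
  rw [div_mul_div_comm, div_mul_div_comm, one_div, le_inv_mul_iff₀ hk, ← mul_div_assoc,
    div_le_div_iff_of_pos_right (mul_pos hDA hDB)]
  exact hcore

end GrowthProcess

end Literature.Probability.Percolation
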